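import Mathlib.Analysis.Distribution.AEEqOfIntegralContDiff
import Mathlib.MeasureTheory.Function.LocallyIntegrable
import Mathlib.MeasureTheory.Group.Integral
import Mathlib.Analysis.Normed.Operator.BoundedLinearMaps
import HarnessLib.Audit
import HarnessLib

/-!
# L3TimeExponentPincer — equivariance under a limit isometry passes to distributional limits

Support kernel (pure measure theory, Mathlib-only) for the crux `L3CascadeJaw`
(item stmt-NavierStokesRegularity-19499) of route `L3TimeExponentPincer`; general form of
`…Theorems.L3TimeExponentPincerTranslationInvariantLimit.ae_comp_add_eq_self_of_tendsto_integral_smul`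
(there the limit map is a translation and the limit linear part is `1`).  Setting: `E` a
finite-dimensional real normed space with a measure `μ` (any measure: translation invariance is not used here), `F` a complete real normed
space, `f_k : E → F` locally integrable with locally uniform `L¹` bounds, converging to `fl` against
every test function `g ∈ C_c^∞(E; ℝ)` (`∫ g • f_k → ∫ g • fl`), each `f_k` equivariant —
`f_k (T_k x) = M_k (f_k x)` a.e. — under a measure-preserving isometry `T_k` of `E` and a
continuous linear `M_k : F → F`.

* `integral_smul_eq_apply_integral_smul_comp_of_tendsto` — if `T_k → Tl` uniformly on bounded
  sets, `Tl` a smooth isometry, and `M_k → Ml` in operator norm, then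
  `∫ g • fl = Ml (∫ (g ∘ Tl) • fl)` for every test function `g`.
* `ae_comp_eq_of_tendsto_integral_smul` — if moreover `Tl` is measure preserving with a smooth
  isometric two-sided inverse `Sl` and `fl` is locally integrable, then **`fl ∘ Tl = Ml ∘ fl`
  a.e.**: equivariance passes to distributional limits.
* helpers `locallyIntegrable_comp_of_measurePreserving`, `locallyIntegrable_clm_comp`.

Used in `…Theorems.L3TimeExponentPincerConvergingAxes`: weak limits of fields axisymmetric about
CONVERGING vertical axes are axisymmetric about the limit axis (the bounded-axis case of the
compactness step (J) of planner nsreg-p2's ROUND-12 §2b, companion of the receding-axis lemma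
`…Theorems.L3TimeExponentPincerRecedingAxis`).  Standard real analysis.
WHAT THIS IS NOT: not NS regularity or blow-up; nothing here mentions the Navier–Stokes equations;
the crux `L3CascadeJaw` is untouched; no crux claim.
-/

noncomputable section

open MeasureTheory Set Function Filter Topology Metric
open scoped ENNReal NNReal ContDiff

namespace Summit.NavierStokesRegularity.NavierStokesRegularity.Theorems.L3TimeExponentPincerEquivariantLimit

variable {E : Type*} [NormedAddCommGroup E] [NormedSpace ℝ E] [FiniteDimensional ℝ E]
  [MeasurableSpace E] [BorelSpace E] {μ : Measure E}
  {F : Type*} [NormedAddCommGroup F] [NormedSpace ℝ F] [CompleteSpace F]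

/-- **Distributional limits of equivariant fields, general limit isometry.**  Let `T_k` be
measure-preserving isometries of `E` converging uniformly on bounded sets to a smooth
measure-preserving isometry `Tl`, `M_k → Ml` in `F →L[ℝ] F`, and `f_k` locally integrable with
locally uniform `L¹` bounds, `T_k`-equivariant (`f_k ∘ T_k = M_k ∘ f_k` a.e.) and converging to `fl`
against every test function `g ∈ C_c^∞(E; ℝ)`.  Then for every such `g`,
`∫ g • fl = Ml (∫ (g ∘ Tl) • fl)`. -/
theorem integral_smul_eq_apply_integral_smul_comp_of_tendsto
    {f : ℕ → E → F} {fl : E → F} {T : ℕ → E → E} {Tl : E → E} {M : ℕ → (F →L[ℝ] F)}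
    {Ml : F →L[ℝ] F}
    (hTμ : ∀ k, MeasurePreserving (T k) μ μ) (hTi : ∀ k, Isometry (T k))
    (hTli : Isometry Tl) (hTld : ContDiff ℝ ∞ Tl)
    (hTc : ∀ R ε : ℝ, 0 < ε → ∀ᶠ k in atTop, ∀ z ∈ closedBall (0 : E) R, ‖T k z - Tl z‖ ≤ ε)
    (hM : Tendsto M atTop (𝓝 Ml))
    (heq : ∀ k, (fun x => f k (T k x)) =ᵐ[μ] fun x => M k (f k x))
    (hf : ∀ k, LocallyIntegrable (f k) μ)
    (hbd : ∀ R : ℝ, ∃ C : ℝ, ∀ k, ∫ x in closedBall (0 : E) R, ‖f k x‖ ∂μ ≤ C)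
    (hconv : ∀ g : E → ℝ, ContDiff ℝ ∞ g → HasCompactSupport g →
      Tendsto (fun k => ∫ x, g x • f k x ∂μ) atTop (𝓝 (∫ x, g x • fl x ∂μ)))
    {g : E → ℝ} (hg : ContDiff ℝ ∞ g) (hgs : HasCompactSupport g) :
    ∫ x, g x • fl x ∂μ = Ml (∫ z, g (Tl z) • fl z ∂μ) := by
  haveI : CompleteSpace E := FiniteDimensional.complete ℝ E
  -- the test function transported by the limit isometry
  have hgc : Continuous g := hg.continuous
  have hg' : ContDiff ℝ ∞ (fun z => g (Tl z)) := hg.comp hTld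
  have hgs' : HasCompactSupport (fun z => g (Tl z)) := hgs.comp_isClosedEmbedding hTli.isClosedEmbedding
  have hgc' : Continuous (fun z => g (Tl z)) := hg'.continuous
  -- notation
  set I : ℕ → F := fun k => ∫ z, g (T k z) • f k z ∂μ with hI_def
  set J : ℕ → F := fun k => ∫ z, g (Tl z) • f k z ∂μ with hJ_def
  set Jlim : F := ∫ z, g (Tl z) • fl z ∂μ with hJlim
  have hgT : ∀ k, Continuous (fun z => g (T k z)) := fun k => hgc.comp (hTi k).continuous
  have hgTs : ∀ k, HasCompactSupport (fun z => g (T k z)) := fun k =>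
    hgs.comp_isClosedEmbedding (hTi k).isClosedEmbedding
  have hintI : ∀ k, Integrable (fun z => g (T k z) • f k z) μ := fun k =>
    (hf k).integrable_smul_left_of_hasCompactSupport (hgT k) (hgTs k)
  have hintJ : ∀ k, Integrable (fun z => g (Tl z) • f k z) μ := fun k =>
    (hf k).integrable_smul_left_of_hasCompactSupport hgc' hgs'
  -- (i) change of variables and equivariance: `∫ g • f_k = M_k (I k)`
  have hI : ∀ k, ∫ x, g x • f k x ∂μ = M k (I k) := by
    intro k
    have hemb : MeasurableEmbedding (T k) := (hTi k).isClosedEmbedding.measurableEmbedding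
    rw [← (hTμ k).integral_comp hemb (fun x => g x • f k x)]
    have hae : (fun z => g (T k z) • f k (T k z)) =ᵐ[μ] fun z => M k (g (T k z) • f k z) := by
      filter_upwards [heq k] with z hz
      rw [hz, map_smul]
    rw [integral_congr_ae hae, ContinuousLinearMap.integral_comp_comm _ (hintI k)]
  -- (ii) `J k → Jlim`
  have hJ : Tendsto J atTop (𝓝 Jlim) := hconv _ hg' hgs'
  -- (iii) `I k - J k → 0`
  have hIJ : Tendsto (fun k => I k - J k) atTop (𝓝 0) := by
    obtain ⟨Rg, hRg⟩ : ∃ R, tsupport g ⊆ closedBall (0 : E) R :=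
      hgs.isCompact.isBounded.subset_closedBall 0
    set R' : ℝ := Rg + ‖Tl 0‖ + 1 with hR'
    obtain ⟨C, hC⟩ := hbd R'
    have hC0 : 0 ≤ C := le_trans (integral_nonneg fun _ => norm_nonneg _) (hC 0)
    rw [Metric.tendsto_atTop]
    intro ε hε
    have hgu : UniformContinuous g := hgs.uniformContinuous_of_continuous hgc
    obtain ⟨δ, hδ, hgδ⟩ := Metric.uniformContinuous_iff.1 hgu (ε / (C + 1)) (by positivity)
    obtain ⟨N, hN⟩ := eventually_atTop.1 ((hTc R' (δ / 2) (by positivity)).and (hTc 0 1 one_pos))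
    refine ⟨N, fun k hk => ?_⟩
    obtain ⟨hk1, hk2⟩ := hN k hk
    have hT0 : ‖T k 0 - Tl 0‖ ≤ 1 := by
      simpa using hk2 0 (mem_closedBall_self le_rfl)
    have hpt : ∀ z, ‖(g (T k z) - g (Tl z)) • f k z‖ ≤
        (closedBall (0 : E) R').indicator (fun z => ε / (C + 1) * ‖f k z‖) z := by
      intro z
      by_cases hz : z ∈ closedBall (0 : E) R'
      · rw [indicator_of_mem hz, norm_smul]
        refine mul_le_mul_of_nonneg_right ?_ (norm_nonneg _)
        have hd : dist (T k z) (Tl z) < δ := by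
          rw [dist_eq_norm]; linarith [hk1 z hz]
        have := hgδ hd
        rw [Real.dist_eq] at this
        exact (Real.norm_eq_abs _).le.trans this.le
      · rw [indicator_of_notMem hz]
        have hz' : R' < ‖z‖ := by simpa [mem_closedBall_zero_iff] using hz
        have h1 : g (Tl z) = 0 := by
          apply image_eq_zero_of_notMem_tsupport
          intro h
          have hTz := mem_closedBall_zero_iff.1 (hRg h)
          have hd : dist (Tl z) (Tl 0) = dist z 0 := hTli.dist_eq z 0
          have h3 : ‖z‖ ≤ ‖Tl z‖ + ‖Tl 0‖ := by
            rw [← dist_zero_right z, ← hd, dist_eq_norm]; exact norm_sub_le _ _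
          linarith
        have h2 : g (T k z) = 0 := by
          apply image_eq_zero_of_notMem_tsupport
          intro h
          have hTz := mem_closedBall_zero_iff.1 (hRg h)
          have hd : dist (T k z) (T k 0) = dist z 0 := (hTi k).dist_eq z 0
          have h3 : ‖z‖ ≤ ‖T k z‖ + ‖T k 0‖ := by
            rw [← dist_zero_right z, ← hd, dist_eq_norm]; exact norm_sub_le _ _
          have h4 : ‖T k 0‖ ≤ ‖Tl 0‖ + 1 := by
            calc ‖T k 0‖ = ‖(T k 0 - Tl 0) + Tl 0‖ := by rw [sub_add_cancel]
              _ ≤ ‖T k 0 - Tl 0‖ + ‖Tl 0‖ := norm_add_le _ _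
              _ ≤ ‖Tl 0‖ + 1 := by linarith
          linarith
        simp [h1, h2]
    have hint : Integrable ((closedBall (0 : E) R').indicator (fun z => ε / (C + 1) * ‖f k z‖)) μ := by
      rw [integrable_indicator_iff measurableSet_closedBall]
      exact (((hf k).integrableOn_isCompact (isCompact_closedBall (0 : E) R')).norm.const_mul _)
    have hdiff : I k - J k = ∫ z, (g (T k z) - g (Tl z)) • f k z ∂μ := by
      rw [hI_def, hJ_def, ← integral_sub (hintI k) (hintJ k)]
      congr 1
      funext z
      rw [sub_smul]
    rw [dist_zero_right, hdiff]
    calc ‖∫ z, (g (T k z) - g (Tl z)) • f k z ∂μ‖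
        ≤ ∫ z, (closedBall (0 : E) R').indicator (fun z => ε / (C + 1) * ‖f k z‖) z ∂μ :=
          norm_integral_le_of_norm_le hint (Eventually.of_forall hpt)
      _ = ε / (C + 1) * ∫ z in closedBall (0 : E) R', ‖f k z‖ ∂μ := by
          rw [integral_indicator measurableSet_closedBall, integral_const_mul]
      _ ≤ ε / (C + 1) * C := by gcongr; exact hC k
      _ < ε := by
          rw [div_mul_eq_mul_div, div_lt_iff₀ (by positivity)]
          nlinarith
  -- (iv) hence `M k (I k) → Ml Jlim`
  have hI' : Tendsto I atTop (𝓝 Jlim) := by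
    have h := hIJ.add hJ
    simp only [sub_add_cancel, zero_add] at h
    exact h
  have hMI : Tendsto (fun k => M k (I k)) atTop (𝓝 (Ml Jlim)) := by
    have hcont := (isBoundedBilinearMap_apply (𝕜 := ℝ) (E := F) (F := F)).continuous
    exact (hcont.tendsto (Ml, Jlim)).comp (hM.prodMk_nhds hI')
  -- (v) identify the limits
  have h1 : Tendsto (fun k => ∫ x, g x • f k x ∂μ) atTop (𝓝 (Ml Jlim)) := by
    have : (fun k => ∫ x, g x • f k x ∂μ) = fun k => M k (I k) := funext hI
    rw [this]; exact hMI
  exact tendsto_nhds_unique (hconv g hg hgs) h1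

omit [NormedSpace ℝ E] [FiniteDimensional ℝ E] [NormedSpace ℝ F] [CompleteSpace F] in
/-- Composition with a measure-preserving homeomorphism (given by a two-sided inverse) preserves
local integrability. -/
theorem locallyIntegrable_comp_of_measurePreserving {f : E → F} (hf : LocallyIntegrable f μ)
    {T S : E → E} (hT : MeasurePreserving T μ μ) (hTc : Continuous T) (hSc : Continuous S)
    (hST : ∀ x, S (T x) = x) (hTS : ∀ x, T (S x) = x) :
    LocallyIntegrable (fun x => f (T x)) μ := by
  let e : E ≃ₜ E :=
    { toFun := T, invFun := S, left_inv := hST, right_inv := hTS,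
      continuous_toFun := hTc, continuous_invFun := hSc }
  have h := (locallyIntegrable_map_homeomorph e (f := f) (μ := μ)).1
  have hmap : Measure.map (⇑e) μ = μ := hT.map_eq
  rw [hmap] at h
  exact h hf

omit [NormedSpace ℝ E] [FiniteDimensional ℝ E] [BorelSpace E] [NormedSpace ℝ F] [CompleteSpace F] in
/-- Composition with a continuous linear map preserves local integrability. -/
theorem locallyIntegrable_clm_comp {f : E → F} (hf : LocallyIntegrable f μ)
    {G : Type*} [NormedAddCommGroup G] [NormedSpace ℝ G] [NormedSpace ℝ F] (L : F →L[ℝ] G) :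
    LocallyIntegrable (fun x => L (f x)) μ := fun x => by
  obtain ⟨s, hs, hint⟩ := hf x
  exact ⟨s, hs, L.integrable_comp hint⟩

/-- **Equivariance passes to distributional limits.**  Under the hypotheses of
`integral_smul_eq_apply_integral_smul_comp_of_tendsto`, if moreover the limit isometry `Tl` has a
smooth isometric two-sided inverse `Sl` and `fl` is locally integrable, then
`fl ∘ Tl = Ml ∘ fl` a.e.  (With `Tl = (· + c)`, `Sl = (· - c)`, `Ml = 1` this is
`ae_comp_add_eq_self_of_tendsto_integral_smul`.) -/
theorem ae_comp_eq_of_tendsto_integral_smul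
    {f : ℕ → E → F} {fl : E → F} {T : ℕ → E → E} {Tl Sl : E → E} {M : ℕ → (F →L[ℝ] F)}
    {Ml : F →L[ℝ] F}
    (hTμ : ∀ k, MeasurePreserving (T k) μ μ) (hTi : ∀ k, Isometry (T k))
    (hTlμ : MeasurePreserving Tl μ μ) (hTli : Isometry Tl) (hTld : ContDiff ℝ ∞ Tl)
    (hSli : Isometry Sl) (hSld : ContDiff ℝ ∞ Sl)
    (hST : ∀ x, Sl (Tl x) = x) (hTS : ∀ x, Tl (Sl x) = x)
    (hTc : ∀ R ε : ℝ, 0 < ε → ∀ᶠ k in atTop, ∀ z ∈ closedBall (0 : E) R, ‖T k z - Tl z‖ ≤ ε)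
    (hM : Tendsto M atTop (𝓝 Ml))
    (heq : ∀ k, (fun x => f k (T k x)) =ᵐ[μ] fun x => M k (f k x))
    (hf : ∀ k, LocallyIntegrable (f k) μ)
    (hbd : ∀ R : ℝ, ∃ C : ℝ, ∀ k, ∫ x in closedBall (0 : E) R, ‖f k x‖ ∂μ ≤ C)
    (hfl : LocallyIntegrable fl μ)
    (hconv : ∀ g : E → ℝ, ContDiff ℝ ∞ g → HasCompactSupport g →
      Tendsto (fun k => ∫ x, g x • f k x ∂μ) atTop (𝓝 (∫ x, g x • fl x ∂μ))) :
    (fun x => fl (Tl x)) =ᵐ[μ] fun x => Ml (fl x) := by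
  haveI : CompleteSpace E := FiniteDimensional.complete ℝ E
  have hflT : LocallyIntegrable (fun x => fl (Tl x)) μ :=
    locallyIntegrable_comp_of_measurePreserving hfl hTlμ hTli.continuous hSli.continuous hST hTS
  have hflM : LocallyIntegrable (fun x => Ml (fl x)) μ := locallyIntegrable_clm_comp hfl Ml
  refine ae_eq_of_integral_contDiff_smul_eq hflT hflM fun h hh hhs => ?_
  -- the test function `g = h ∘ Sl` has `g ∘ Tl = h`
  have hg : ContDiff ℝ ∞ (fun y => h (Sl y)) := hh.comp hSld
  have hgs : HasCompactSupport (fun y => h (Sl y)) := hhs.comp_isClosedEmbedding hSli.isClosedEmbedding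
  have key := integral_smul_eq_apply_integral_smul_comp_of_tendsto hTμ hTi hTli hTld hTc hM heq hf
    hbd hconv hg hgs
  simp only [hST] at key
  -- `∫ (h ∘ Sl) • fl = ∫ h • (fl ∘ Tl)` by the change of variables `y = Tl x`
  have hemb : MeasurableEmbedding Tl := hTli.isClosedEmbedding.measurableEmbedding
  have hcv : ∫ y, h (Sl y) • fl y ∂μ = ∫ x, h x • fl (Tl x) ∂μ := by
    rw [← hTlμ.integral_comp hemb (fun y => h (Sl y) • fl y)]
    simp only [hST]
  rw [← hcv, key, ← ContinuousLinearMap.integral_comp_comm _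
    (hfl.integrable_smul_left_of_hasCompactSupport hh.continuous hhs)]
  simp only [map_smul]

end Summit.NavierStokesRegularity.NavierStokesRegularity.Theorems.L3TimeExponentPincerEquivariantLimit

end
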